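import Summits.AnomalousDissipation.AnomalousDissipation.Theses.WindLine
import Summits.AnomalousDissipation.AnomalousDissipation.Theorems.WindLineWindLineFeedsTarget
import Summits.AnomalousDissipation.AnomalousDissipation.Theorems.WindLineWindLineReachesCalmEnergy
import Summits.AnomalousDissipation.AnomalousDissipation.Theorems.WindLineCyclicWindLineLoudStubFarShoreOnWindLine
import Summits.AnomalousDissipation.AnomalousDissipation.Theorems.WindLineCyclicWindLineLoudStubFarShoreNonempty

/-!
# Crux `CyclicWindLineLoud` (stmt-AnomalousDissipation-11415, route WindLine, rank 2) — line `birth` skeleton, v3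

Lead copy (prover-line-stmt-AnomalousDissipation-11415-c2, 2026-08-17). History: v0 = planner-registered
`Lines/birth.lean` (SHORE → CROSSING → POWER, 3 stubs, sha ae38bcc2); v1 = lead-0 reshape of stub 2 to COMPONENT form
(sha 7af7c5f3); v2 = lead c1 (sha 3b3c036e): stub 1 CLOSED (wave 1, p143523) and the two bets RESHAPED into their weakest
composable forms, with the remaining provable structure split off; v3 = THIS file (lead c2): stub 2a CLOSED (p145058) and
used as a theorem, so the registered stubs are exactly the two ν-uniformity bets —

* `stub_farShoreOnWindLine` (STRUCTURE, CLOSED p143523): beyond a wind threshold every windy steady state is on the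
  wind-line (`Theorems/WindLineCyclicWindLineLoudStubFarShoreOnWindLine.lean`).
* `stub_farShoreNonempty` (STRUCTURE, CLOSED p145058): at every `(ν, N)` the windy variety has states of arbitrarily
  large prescribed wind (`Theorems/WindLineCyclicWindLineLoudStubFarShoreNonempty.lean`, Browder slab).
* `stub_windLineReachesBoundedCalm` (ENERGY / REACHABILITY bet, L–XL): for all small `ν` and all large `N` THE wind-line
  (the component of any point reaching arbitrarily large wind) carries a CALM state of energy `≤ E`, `E` uniform in `ν`
  (v1's `stub_boundedCalmStateFromShore` restated for the wind-line itself; its ν-DEPENDENT core `E(ν) = 3/(4π²ν)²` is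
  proved in `Lines/birth_stub2_apriori.lean`, wave 1).
* `stub_windLineLoudIfBoundedCalm` (ANOMALY bet, XL, hardest, held by the lead): for every `E` there are `E', ε, ν₀` with:
  for `ν < ν₀` and infinitely many `N`, IF the wind-line carries a calm state of energy `≤ E` THEN it carries a (calm or
  windy) state of energy `≤ E'` with injected power `Σ Re⟪ĝ_k, c_k⟫ ≥ ε` (v1's UNIVERSAL power floor
  `stub_boundedCalmCrossingsPowerFloor` — every bounded calm wind-line state loud — replaced by the EXISTENTIAL form the crux
  actually needs; a single quiet bounded crossing no longer kills the line).

Composition `CyclicWindLineLoud_of : stub₂ᵦ → stub₃ → CyclicWindLineLoud` (no sorry; hypotheses = the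
name-keyed aliases `__Registered.stub_*` of the OPEN stubs — the closed stubs 1 and 2a are used inside as theorems; wiring `example` at the end): `ν_j := min ν₀ ν₁ / (j + 2) → 0⁺`; at each `j`,
`∀ᶠ N` (2b) and `∃ᶠ N` (3) combine to `∃ᶠ N`; at such `N`: threshold `s₁` (1), shore state `a` of wind `≥ s₁` (2a), `a`
on the wind-line (1), bounded calm `c ∈ connectedComponentIn V a` (2b), `c` on the wind-line (`connectedComponentIn_eq`),
loud bounded wind-line state `c'` (3), energy identity at the zero `c'` (`Theorems.WindLineReachesCalm.sum_re_inner_galerkinRHS_eq`: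
the wind does no work) turns `ε ≤ Σ Re⟪ĝ_k, c'_k⟫` into `ε ≤ ν_j·4π² Σ|k|²‖c'_k‖²`.

The crux: for the cyclic force `f = (sin 2πx₃, sin 2πx₁, sin 2πx₂)` and the non-resonant wind direction `e = (1, √2, √3)`,
viscosities `ν_j → 0⁺` and constants `E, ε > 0` such that for every `j` and infinitely many resolutions `N` the WIND-LINE of
the fixed-`ν_j` windy steady Galerkin variety `V = {c ∈ galerkinSubspace (freqBall N) : c 0 ∈ ℝ·e, galerkinRHS ν_j ĝ c = 0}`
carries a state of total energy `Σ‖c_k‖² ≤ E` and dissipation `ν_j·4π² Σ|k|²‖c_k‖² ≥ ε`.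

Disproof used: none exists (no `Disproof.lean`, no `Negative/` for this crux, `ledger crux ls`, 2026-08-17T11Z). Negatives
index of the summit: nothing on steady Galerkin states / the wind-line / the cyclic force.

Hardest stub: `stub_windLineLoudIfBoundedCalm` (its failure mode — only WARM bounded states on the wind-line at small `ν`,
i.e. wind-reachable near-Euler frustrated steady states with `⟨f,u⟩ → 0` — is the crux's recorded why-might-fail; its
a-priori core is a power floor of order `ν`, and at fixed `ν` an `N`-uniform floor by compactness; the content is
`liminf_{ν→0} > 0`). Sources: Nagata1990, Waleffe2003 (states reached by homotopy in an auxiliary parameter),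
FoiasTemam1977 / TemamNSNFA1995 Thm 10.4 (generic finiteness and parity of steady states), Browder1960 / SolanSolan2023
(continuation), RobinsonRodrigoSadowski2016 §4.1 and Temam1979 Ch. II (1.29)–(1.30) (Galerkin energy identity and a-priori
bound), DoeringFoias2002 (energy dissipation in body-forced flows).
-/

-- `Summit.<Summit>.<Problem>` is the tree's mandated summit-side namespace (CONVENTIONS §2); for this
-- single-conjunct summit the two coincide, so the duplicate is deliberate.
set_option linter.dupNamespace false

noncomputable section

open scoped BigOperators InnerProductSpace ComplexConjugate
open Filter Set Topology

namespace Summit.AnomalousDissipation.AnomalousDissipation.Cruxes.CyclicWindLineLoud.Birth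

/-- **stub 1 — the far shore lies on the wind-line** (STRUCTURE; CLOSED in wave 1, p143523, file
`Theorems/WindLineCyclicWindLineLoudStubFarShoreOnWindLine.lean`, decl
`…Theorems.CyclicWindLineLoud.FarShore.stub_farShoreOnWindLine`). For the cyclic force and `e = (1, √2, √3)`, at
every viscosity `ν > 0` and resolution `N` there is a wind threshold `s₁` such that every windy steady Galerkin state
`c ∈ V` of wind `s ≥ s₁` (`c 0 = s·e`) lies on the wind-line: its connected component in `V` reaches every wind `Λ`
(a-priori wake bound, large-wind uniqueness for the non-resonant `e`, Browder continuum through the unique point of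
wind `s`). [folklore] -/
theorem stub_farShoreOnWindLine :
    ∀ ν : ℝ, 0 < ν → ∀ (N : ℕ) (S : Finset (Fin 3 → ℤ)), S = Literature.Analysis.FunctionSpaces.Torus.freqBall N → ∀ V : Set (↥S → EuclideanSpace ℂ (Fin 3)), V = {c | c ∈ Literature.Analysis.FluidPDE.galerkinSubspace S ∧ (∃ s : ℝ, ∀ k : ↥S, (k : Fin 3 → ℤ) = 0 → c k = (s : ℂ) • !₂[(1 : ℂ), ((Real.sqrt 2 : ℝ) : ℂ), ((Real.sqrt 3 : ℝ) : ℂ)]) ∧ Literature.Analysis.FluidPDE.galerkinRHS S ν (fun k : ↥S => UnitAddTorus.mFourierCoeff (Literature.Analysis.FunctionSpaces.EuclideanSpace.complexify ∘ fun x : UnitAddTorus (Fin 3) => !₂[(fourier 1 (x 2) : ℂ).im, (fourier 1 (x 0) : ℂ).im, (fourier 1 (x 1) : ℂ).im]) (k : Fin 3 → ℤ)) c = 0} → ∃ s₁ : ℝ, ∀ c ∈ V, ∀ s : ℝ, s₁ ≤ s → (∀ k : ↥S, (k : Fin 3 → ℤ) = 0 → c k = (s : ℂ) • !₂[(1 :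 ℂ), ((Real.sqrt 2 : ℝ) : ℂ), ((Real.sqrt 3 : ℝ) : ℂ)]) → ∀ Λ : ℝ, ∃ c' ∈ connectedComponentIn V c, ∃ s' : ℝ, (∀ k : ↥S, (k : Fin 3 → ℤ) = 0 → c' k = (s' : ℂ) • !₂[(1 : ℂ), ((Real.sqrt 2 : ℝ) : ℂ), ((Real.sqrt 3 : ℝ) : ℂ)]) ∧ Λ ≤ s' :=
  Summit.AnomalousDissipation.AnomalousDissipation.Theorems.CyclicWindLineLoud.FarShore.stub_farShoreOnWindLine

/-- **stub 2a — the far shore is never empty** (STRUCTURE; CLOSED p145058, decl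
`…Theorems.CyclicWindLineLoud.CalmFromShore.stub_farShoreNonempty`). At every `ν > 0` and every
resolution `N`, the windy variety `V` contains states of arbitrarily large prescribed wind: `∀ s₁, ∃ a ∈ V` with
`a 0 = s·e`, `s ≥ s₁`. Why true: the Browder continuum of zeros of the parametrised calm field over the wind slab
`[0, max s₁ 0]` (`exists_isConnected_zeros_of_bilin_coercive`, coercivity `sum_re_inner_galerkinRHS_le`, force vector real
solenoidal without mean mode) projects ONTO the slab, so it has a point of wind exactly `max s₁ 0` (lead wave 1: proved as
`exists_calm_in_component_of_wind_ge` in `Cruxes/CyclicWindLineLoud/Lines/birth_stub2_apriori.lean`, general `d, S, e`);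
alternatively the contraction of `Theses.WindLine.WindyShoreUniform` (proved) gives the shore state for `|s| ≥ s₀`.
Leans on: `Theorems.WindLineReachesCalm.{exists_isConnected_zeros_of_bilin_coercive, sum_re_inner_galerkinRHS_le,
galerkinRHS_apply_zero, single_complexify_mem_galerkinSubspace}`, `Theorems.CyclicWindLineLoud.FarShore.{complexify_windDir,
cycCoeff_mem_galerkinSubspace, cycCoeff_zero}`. Why it might fail: it should not. -/
theorem stub_farShoreNonempty :
    ∀ ν : ℝ, 0 < ν → ∀ (N : ℕ) (S : Finset (Fin 3 → ℤ)), S = Literature.Analysis.FunctionSpaces.Torus.freqBall N → ∀ V : Set (↥S → EuclideanSpace ℂ (Fin 3)), V = {c | c ∈ Literature.Analysis.FluidPDE.galerkinSubspace S ∧ (∃ s : ℝ, ∀ k : ↥S, (k : Fin 3 → ℤ) = 0 → c k = (s : ℂ) • !₂[(1 : ℂ), ((Real.sqrt 2 : ℝ) : ℂ), ((Real.sqrt 3 : ℝ) : ℂ)]) ∧ Literature.Analysis.FluidPDE.galerkinRHS S ν (fun k : ↥S => UnitAddTorus.mFourierCoeff (Literature.Analysis.FunctionSpaces.EuclideanSpace.complexify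 ∘ fun x : UnitAddTorus (Fin 3) => !₂[(fourier 1 (x 2) : ℂ).im, (fourier 1 (x 0) : ℂ).im, (fourier 1 (x 1) : ℂ).im]) (k : Fin 3 → ℤ)) c = 0} → ∀ s₁ : ℝ, ∃ a ∈ V, ∃ s : ℝ, s₁ ≤ s ∧ (∀ k : ↥S, (k : Fin 3 → ℤ) = 0 → a k = (s : ℂ) • !₂[(1 : ℂ), ((Real.sqrt 2 : ℝ) : ℂ), ((Real.sqrt 3 : ℝ) : ℂ)]) :=
  Summit.AnomalousDissipation.AnomalousDissipation.Theorems.CyclicWindLineLoud.CalmFromShore.stub_farShoreNonempty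

/-- **stub 2b — the wind-line reaches the calm slice inside a ν-uniform energy ball** (the ENERGY /
REACHABILITY bet; size L–XL; lead reshape 2026-08-17, cycle 1: stated for THE wind-line directly — `a` any point whose
component reaches arbitrarily large wind — instead of "the component of a shore state of wind `≥ s₁`"; given stub 1 the two
are the same component, and the calm-existence part without energy bound is the tree's `windLine_reaches_calm`). There are
an energy cap `E` and `ν₀ > 0` such that for every `0 < ν < ν₀` and all large resolutions `N`, the connected component in
`V` of every wind-line point `a` contains a CALM steady state `c` (`c 0 = 0`) of total energy `Σ‖c_k‖² ≤ E` — E INDEPENDENT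
of `ν`. What is proved (lead wave 1, `Lines/birth_stub2_apriori.lean`, 0 sorries): the same matrix at EVERY `ν > 0` and
EVERY `N` with the ν-dependent cap `E(ν) = 3/(4π²ν)²` (Browder slab + Temam's a-priori bound
`sqrt_calmEnergy_le_of_galerkinRHS_eq_zero` + Bessel `Σ_{k∈S}‖ĝ_k‖² ≤ 3`); the content of the stub is exactly
`sup_ν E(ν) < ∞` for SOME calm state of the wind-line, for which no coercive/Lyapunov functional uniform in `ν` is known
(kit j001712, K² = 6: 46 / 89 bounded calm crossings with ⟨|U|²⟩ ≤ 34 / 60 at ν = 10⁻² / 10⁻³, box units, under-resolved).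
Why it might fail: every calm crossing of the wind-line may have energy → ∞ as ν → 0 (the wind-line could cross the calm
slice only near the laminar sheet, energy ~ ν⁻²), or bounded crossings may exist only for sporadic `N`.
Sources: Nagata1990, Waleffe2003, OkamotoShoji1993, FoiasTemam1977, Temam1979 Ch. II (1.30), the j001712 computation. -/
theorem stub_windLineReachesBoundedCalm :
    ∃ E ν₀ : ℝ, 0 < ν₀ ∧ ∀ ν : ℝ, 0 < ν → ν < ν₀ → ∀ᶠ N in Filter.atTop, ∀ (S : Finset (Fin 3 → ℤ)), S = Literature.Analysis.FunctionSpaces.Torus.freqBall N → ∀ V : Set (↥S → EuclideanSpace ℂ (Fin 3)), V = {c | c ∈ Literature.Analysis.FluidPDE.galerkinSubspace S ∧ (∃ s : ℝ, ∀ k : ↥S, (k : Fin 3 → ℤ) = 0 → c k = (s : ℂ) • !₂[(1 : ℂ), ((Real.sqrt 2 : ℝ) : ℂ), ((Real.sqrt 3 : ℝ) : ℂ)]) ∧ Literature.Analysis.FluidPDE.galerkinRHS S ν (fun k : ↥S => UnitAddTorus.mFourierCoeff (Literature.Analysis.FunctionSpaces.EuclideanSpace.complexify ∘ fun x : UnitAddTorus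 (Fin 3) => !₂[(fourier 1 (x 2) : ℂ).im, (fourier 1 (x 0) : ℂ).im, (fourier 1 (x 1) : ℂ).im]) (k : Fin 3 → ℤ)) c = 0} → ∀ a ∈ V, (∀ Λ : ℝ, ∃ c' ∈ connectedComponentIn V a, ∃ s : ℝ, (∀ k : ↥S, (k : Fin 3 → ℤ) = 0 → c' k = (s : ℂ) • !₂[(1 : ℂ), ((Real.sqrt 2 : ℝ) : ℂ), ((Real.sqrt 3 : ℝ) : ℂ)]) ∧ Λ ≤ s) → ∃ c ∈ connectedComponentIn V a, (∀ k : ↥S, (k : Fin 3 → ℤ) = 0 → c k = 0) ∧ ∑ k : ↥S, ‖c k‖ ^ 2 ≤ E := by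
  sorry

/-- **stub 3 — if the wind-line reaches bounded energy calmly, it carries a LOUD bounded state** (the ANOMALY
bet, EXISTENTIAL form; size XL, the hardest stub, held by the lead; lead reshape 2026-08-17, cycle 1, replacing the
UNIVERSAL power floor `stub_boundedCalmCrossingsPowerFloor` — "every bounded calm wind-line state is loud" — which a single
quiet bounded crossing would kill although the crux needs only one loud state; the crossing loudness already spreads by a
factor 2 at K² = 6, ν = 10⁻² in kit j001712). For every energy level `E` there are `E'`, `ε > 0` and `ν₀ > 0` such that for
every `0 < ν < ν₀` and infinitely many `N`: IF the wind-line carries a calm state of energy `≤ E`, THEN it carries a state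
`c` (calm or windy — the wind does no work) of energy `Σ‖c_k‖² ≤ E'` receiving injected power `Σ_k Re⟪ĝ_k, c_k⟫ ≥ ε` from
the cyclic force; the composition turns power into dissipation `ν·4π²Σ|k|²‖c_k‖² ≥ ε` by the energy identity at a zero of
the Galerkin field (`sum_re_inner_galerkinRHS_eq`). The power functional is linear in `c`, supported on the six first-shell
modes, continuous under weak limits, so the statement is decided by the resolved large scales and passes to `N → ∞`,
`ν → 0` limits. What is provable a priori (first-shell balance `ĝ_k = 4π²ν c_k + Π_k B_k(c,c)` with the SHARP transversal
bound `‖B_k(c,c)‖ ≤ 2π|k| Σ‖c_m‖²`, and `P = 4π²ν Σ|k|²‖c_k‖² ≥ 4π²ν Σ_{k≠0}‖c_k‖²`): every calm zero of energy `≤ E` has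
energy `≥ (1/2 − 4π²ν√E)/(2π)` and power `≥ πν − 8π³ν²√E` — a floor of order `ν` only; and at FIXED `ν`, by the
`N → ∞` compactness of bounded steady states (`Theses.WindLine.WindySteadyLimit` machinery), an `N`-uniform floor
`m(ν, E) > 0`; the content is `liminf_{ν→0} > 0`, i.e. the zeroth law for the steady states the wind reaches.
Why it might fail: all bounded wind-line states may be WARM — near-Euler frustrated steady states (a steady solution of
forced Euler has `(f, u) = 0` identically) with `⟨f,u⟩ → 0` at energy `O(1)` as `ν → 0` (WindNeverLoud may be true); in kit
j001712 crossing loudness fell from 0.69–1.46 (ν = 10⁻²) to ≤ 0.29 (ν = 10⁻³, under ⟨|U|²⟩ ≤ 60) at the under-resolved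
K² = 6, tracking the cap `4π²νN²E`. Sources: Nagata1990, Waleffe2003, FranceschiniTebaldiZironi1984, Okamoto1998,
BrachetEtAl1983, AlexakisDoering2006PLA, Cheskidov2023, DoeringFoias2002. -/
theorem stub_windLineLoudIfBoundedCalm :
    ∀ E : ℝ, ∃ E' ε ν₀ : ℝ, 0 < ε ∧ 0 < ν₀ ∧ ∀ ν : ℝ, 0 < ν → ν < ν₀ → ∃ᶠ N in Filter.atTop, ∀ (S : Finset (Fin 3 → ℤ)), S = Literature.Analysis.FunctionSpaces.Torus.freqBall N → ∀ V : Set (↥S → EuclideanSpace ℂ (Fin 3)), V = {c | c ∈ Literature.Analysis.FluidPDE.galerkinSubspace S ∧ (∃ s : ℝ, ∀ k : ↥S, (k : Fin 3 → ℤ) = 0 → c k = (s : ℂ) • !₂[(1 : ℂ), ((Real.sqrt 2 : ℝ) : ℂ), ((Real.sqrt 3 : ℝ) : ℂ)]) ∧ Literature.Analysis.FluidPDE.galerkinRHS S ν (fun k : ↥S => UnitAddTorus.mFourierCoeff (Literature.Analysis.FunctionSpaces.EuclideanSpace.complexify ∘ fun x : UnitAddTorus (Fin 3) => !₂[(fourier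 1 (x 2) : ℂ).im, (fourier 1 (x 0) : ℂ).im, (fourier 1 (x 1) : ℂ).im]) (k : Fin 3 → ℤ)) c = 0} → (∃ c ∈ V, (∀ k : ↥S, (k : Fin 3 → ℤ) = 0 → c k = 0) ∧ (∀ Λ : ℝ, ∃ c' ∈ connectedComponentIn V c, ∃ s : ℝ, (∀ k : ↥S, (k : Fin 3 → ℤ) = 0 → c' k = (s : ℂ) • !₂[(1 : ℂ), ((Real.sqrt 2 : ℝ) : ℂ), ((Real.sqrt 3 : ℝ) : ℂ)]) ∧ Λ ≤ s) ∧ ∑ k : ↥S, ‖c k‖ ^ 2 ≤ E) → ∃ c ∈ V, (∀ Λ : ℝ, ∃ c' ∈ connectedComponentIn V c, ∃ s : ℝ, (∀ k : ↥S, (k : Fin 3 → ℤ) = 0 → c' k = (s : ℂ) • !₂[(1 : ℂ), ((Real.sqrt 2 : ℝ) : ℂ), ((Real.sqrt 3 : ℝ) : ℂ)]) ∧ Λ ≤ s) ∧ ∑ k : ↥S, ‖c k‖ ^ 2 ≤ E' ∧ ε ≤ ∑ k : ↥S, (inner ℂ (UnitAddTorus.mFourierCoeff (Literature.Analysis.FunctionSpaces.EuclideanSpace.complexify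 ∘ fun x : UnitAddTorus (Fin 3) => !₂[(fourier 1 (x 2) : ℂ).im, (fourier 1 (x 0) : ℂ).im, (fourier 1 (x 1) : ℂ).im]) ((k : ↥S) : Fin 3 → ℤ)) (c k)).re := by
  sorry

/-! ## Name-keyed aliases of the stub statements — the hypotheses of `CyclicWindLineLoud_of`

(`__Registered.stub_X` is the statement of `stub_X` verbatim under the stub's short name; the native skeleton audit
resolves each to the theorem above. Generated from the same source text.) -/
namespace __Registered

/-- Alias of the statement of `stub_windLineReachesBoundedCalm` (ν-uniformly bounded calm state on the wind-line), keyed by the stub name. -/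
abbrev stub_windLineReachesBoundedCalm : Prop :=
  ∃ E ν₀ : ℝ, 0 < ν₀ ∧ ∀ ν : ℝ, 0 < ν → ν < ν₀ → ∀ᶠ N in Filter.atTop, ∀ (S : Finset (Fin 3 → ℤ)), S = Literature.Analysis.FunctionSpaces.Torus.freqBall N → ∀ V : Set (↥S → EuclideanSpace ℂ (Fin 3)), V = {c | c ∈ Literature.Analysis.FluidPDE.galerkinSubspace S ∧ (∃ s : ℝ, ∀ k : ↥S, (k : Fin 3 → ℤ) = 0 → c k = (s : ℂ) • !₂[(1 : ℂ), ((Real.sqrt 2 : ℝ) : ℂ), ((Real.sqrt 3 : ℝ) : ℂ)]) ∧ Literature.Analysis.FluidPDE.galerkinRHS S ν (fun k : ↥S => UnitAddTorus.mFourierCoeff (Literature.Analysis.FunctionSpaces.EuclideanSpace.complexify ∘ fun x : UnitAddTorus (Fin 3) => !₂[(fourier 1 (x 2) : ℂ).im, (fourier 1 (x 0) : ℂ).im, (fourier 1 (x 1) : ℂ).im]) (k : Fin 3 → ℤ)) c = 0} → ∀ a ∈ V, (∀ Λ : ℝ, ∃ c' ∈ connectedComponentIn V a, ∃ s : ℝ,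 (∀ k : ↥S, (k : Fin 3 → ℤ) = 0 → c' k = (s : ℂ) • !₂[(1 : ℂ), ((Real.sqrt 2 : ℝ) : ℂ), ((Real.sqrt 3 : ℝ) : ℂ)]) ∧ Λ ≤ s) → ∃ c ∈ connectedComponentIn V a, (∀ k : ↥S, (k : Fin 3 → ℤ) = 0 → c k = 0) ∧ ∑ k : ↥S, ‖c k‖ ^ 2 ≤ E

/-- Alias of the statement of `stub_windLineLoudIfBoundedCalm` (bounded calm ⇒ loud bounded on the wind-line), keyed by the stub name. -/
abbrev stub_windLineLoudIfBoundedCalm : Prop :=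
  ∀ E : ℝ, ∃ E' ε ν₀ : ℝ, 0 < ε ∧ 0 < ν₀ ∧ ∀ ν : ℝ, 0 < ν → ν < ν₀ → ∃ᶠ N in Filter.atTop, ∀ (S : Finset (Fin 3 → ℤ)), S = Literature.Analysis.FunctionSpaces.Torus.freqBall N → ∀ V : Set (↥S → EuclideanSpace ℂ (Fin 3)), V = {c | c ∈ Literature.Analysis.FluidPDE.galerkinSubspace S ∧ (∃ s : ℝ, ∀ k : ↥S, (k : Fin 3 → ℤ) = 0 → c k = (s : ℂ) • !₂[(1 : ℂ), ((Real.sqrt 2 : ℝ) : ℂ), ((Real.sqrt 3 : ℝ) : ℂ)]) ∧ Literature.Analysis.FluidPDE.galerkinRHS S ν (fun k : ↥S => UnitAddTorus.mFourierCoeff (Literature.Analysis.FunctionSpaces.EuclideanSpace.complexify ∘ fun x : UnitAddTorus (Fin 3) => !₂[(fourier 1 (x 2) : ℂ).im, (fourier 1 (x 0) : ℂ).im, (fourier 1 (x 1) : ℂ).im]) (k : Fin 3 → ℤ)) c = 0} → (∃ c ∈ V, (∀ k : ↥S, (k : Fin 3 → ℤ) = 0 → c k = 0) ∧ (∀ Λ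 : ℝ, ∃ c' ∈ connectedComponentIn V c, ∃ s : ℝ, (∀ k : ↥S, (k : Fin 3 → ℤ) = 0 → c' k = (s : ℂ) • !₂[(1 : ℂ), ((Real.sqrt 2 : ℝ) : ℂ), ((Real.sqrt 3 : ℝ) : ℂ)]) ∧ Λ ≤ s) ∧ ∑ k : ↥S, ‖c k‖ ^ 2 ≤ E) → ∃ c ∈ V, (∀ Λ : ℝ, ∃ c' ∈ connectedComponentIn V c, ∃ s : ℝ, (∀ k : ↥S, (k : Fin 3 → ℤ) = 0 → c' k = (s : ℂ) • !₂[(1 : ℂ), ((Real.sqrt 2 : ℝ) : ℂ), ((Real.sqrt 3 : ℝ) : ℂ)]) ∧ Λ ≤ s) ∧ ∑ k : ↥S, ‖c k‖ ^ 2 ≤ E' ∧ ε ≤ ∑ k : ↥S, (inner ℂ (UnitAddTorus.mFourierCoeff (Literature.Analysis.FunctionSpaces.EuclideanSpace.complexify ∘ fun x : UnitAddTorus (Fin 3) => !₂[(fourier 1 (x 2) : ℂ).im, (fourier 1 (x 0) : ℂ).im, (fourier 1 (x 1) : ℂ).im]) ((k : ↥S) : Fin 3 → ℤ)) (c k)).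re

end __Registered

/-- **Composition** (kernel-checked, no `sorry` of its own, axioms `propext / Classical.choice / Quot.sound`): the open
stub statements (as the name-keyed aliases `__Registered.stub_*`; the closed stubs 1 and 2a enter as the landed theorems) imply the crux
`Summit.AnomalousDissipation.AnomalousDissipation.Theses.WindLine.CyclicWindLineLoud` BY NAME. Sequence
`ν_j := min ν₀ ν₁ / (j + 2) → 0⁺`; `∃ᶠ ∧ ∀ᶠ ⇒ ∃ᶠ`; at a served `N`: shore threshold `s₁` (stub 1), a shore state `a` of
wind `≥ s₁` (stub 2a) is on the wind-line (stub 1), its component carries a bounded calm state `c` (stub 2b), which is on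
the wind-line (`connectedComponentIn_eq`), so stub 3 yields a wind-line state `c'` of energy `≤ E'` and power `≥ ε`, and the
energy identity at the zero `c'` (`sum_re_inner_galerkinRHS_eq`: the wind does no work) gives dissipation `≥ ε`. [folklore] -/
theorem CyclicWindLineLoud_of :
    __Registered.stub_windLineReachesBoundedCalm → __Registered.stub_windLineLoudIfBoundedCalm →
      Summit.AnomalousDissipation.AnomalousDissipation.Theses.WindLine.CyclicWindLineLoud := by
  intro hReach hLoud
  -- stubs 1 (p143523) and 2a (p145058) are CLOSED: used as theorems, not hypotheses
  have hShore := stub_farShoreOnWindLine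
  have hNonempty := stub_farShoreNonempty
  dsimp only [__Registered.stub_windLineReachesBoundedCalm, __Registered.stub_windLineLoudIfBoundedCalm] at hReach hLoud
  obtain ⟨E, ν₀, hν₀, hReach⟩ := hReach
  obtain ⟨E', ε, ν₁, hε, hν₁, hLoud⟩ := hLoud E
  -- the viscosity sequence `ν_j := μ / (j + 2)`, `μ := min ν₀ ν₁`
  set μ : ℝ := min ν₀ ν₁ with hμ
  have hμ0 : 0 < μ := lt_min hν₀ hν₁
  have hpos : ∀ j : ℕ, 0 < μ / ((j : ℝ) + 2) := fun j => by positivity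
  have hlt : ∀ j : ℕ, μ / ((j : ℝ) + 2) < μ := fun j => by
    rw [div_lt_iff₀ (by positivity)]
    have hj : (0 : ℝ) ≤ (j : ℝ) := Nat.cast_nonneg j
    nlinarith
  refine ⟨fun j => μ / ((j : ℝ) + 2), E', ε, hpos, ?_, hε, fun j => ?_⟩
  · exact tendsto_const_nhds.div_atTop
      (tendsto_atTop_add_const_right _ _ tendsto_natCast_atTop_atTop)
  · have hlt₀ : μ / ((j : ℝ) + 2) < ν₀ := (hlt j).trans_le (min_le_left _ _)
    have hlt₁ : μ / ((j : ℝ) + 2) < ν₁ := (hlt j).trans_le (min_le_right _ _)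
    have hA := hReach _ (hpos j) hlt₀
    have hB := hLoud _ (hpos j) hlt₁
    refine (hB.and_eventually hA).mono ?_
    rintro N ⟨hBN, hAN⟩ S hSdef V hVdef
    -- shore threshold (stub 1) and a shore state (stub 2a)
    obtain ⟨s₁, hs₁⟩ := hShore _ (hpos j) N S hSdef V hVdef
    obtain ⟨a, haV, s, hs, has⟩ := hNonempty _ (hpos j) N S hSdef V hVdef s₁
    -- the shore state is on the wind-line (stub 1); its component carries a bounded calm state (stub 2b)
    have hwa := hs₁ a haV s hs has
    obtain ⟨c, hca, hcalm, hEc⟩ := hAN S hSdef V hVdef a haV hwa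
    have hcV : c ∈ V := connectedComponentIn_subset _ _ hca
    have hcomp : connectedComponentIn V c = connectedComponentIn V a :=
      (connectedComponentIn_eq hca).symm
    have hwc : ∀ Λ : ℝ, ∃ c' ∈ connectedComponentIn V c, ∃ s : ℝ, (∀ k : ↥S, (k : Fin 3 → ℤ) = 0 →
        c' k = (s : ℂ) • !₂[(1 : ℂ), ((Real.sqrt 2 : ℝ) : ℂ), ((Real.sqrt 3 : ℝ) : ℂ)]) ∧ Λ ≤ s := by
      intro Λ
      rw [hcomp]
      exact hwa Λ
    -- stub 3: a loud bounded wind-line state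
    obtain ⟨c', hc'V, hwc', hEc', hP⟩ := hBN S hSdef V hVdef ⟨c, hcV, hcalm, hwc, hEc⟩
    refine ⟨c', hc'V, hwc', hEc', ?_⟩
    -- the energy identity at the zero `c'` of the Galerkin field: power = dissipation (the wind does no work)
    have hcV' := hc'V
    rw [hVdef, Set.mem_setOf_eq] at hcV'
    obtain ⟨hcG, -, hcz⟩ := hcV'
    subst hSdef
    have hsym : ∀ k ∈ Literature.Analysis.FunctionSpaces.Torus.freqBall (d := Fin 3) N,
        -k ∈ Literature.Analysis.FunctionSpaces.Torus.freqBall N :=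
      Literature.Analysis.FunctionSpaces.Torus.neg_mem_freqBall_of_mem
    have hg : Literature.Analysis.FunctionSpaces.Torus.IsRealCoeff
        (S := Literature.Analysis.FunctionSpaces.Torus.freqBall N)
        (fun k => UnitAddTorus.mFourierCoeff (Literature.Analysis.FunctionSpaces.EuclideanSpace.complexify ∘
          fun x : UnitAddTorus (Fin 3) => !₂[(fourier 1 (x 2) : ℂ).im, (fourier 1 (x 0) : ℂ).im, (fourier 1 (x 1) : ℂ).im])
            ((k : ↥(Literature.Analysis.FunctionSpaces.Torus.freqBall N)) : Fin 3 → ℤ)) :=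
      Literature.Analysis.FunctionSpaces.Torus.isRealCoeff_mFourierCoeff
        (Summit.AnomalousDissipation.AnomalousDissipation.Theorems.WindLineCyclic.isSmooth_cycForce).integrable
    have hid := Summit.AnomalousDissipation.AnomalousDissipation.Theorems.WindLineReachesCalm.sum_re_inner_galerkinRHS_eq
      (μ / ((j : ℝ) + 2)) hsym hg hcG
    rw [hcz] at hid
    simp only [Pi.zero_apply, inner_zero_right, Complex.zero_re, Finset.sum_const_zero] at hid
    linarith

/-- WIRING CHECK: the stubs compose to a closed term of the crux's type (modulo the `sorry`s of the open ones). Deliberately an `example` (no constant enters the environment). -/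
example : Summit.AnomalousDissipation.AnomalousDissipation.Theses.WindLine.CyclicWindLineLoud :=
  CyclicWindLineLoud_of stub_windLineReachesBoundedCalm stub_windLineLoudIfBoundedCalm

end Summit.AnomalousDissipation.AnomalousDissipation.Cruxes.CyclicWindLineLoud.Birth

end
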